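import Summits.AtomisticToContinuum.FouriersLaw.Theorems.EmbeddedDrudeMourreAbelThermodynamicLimitAnchoredCorrelationTails
import Summits.AtomisticToContinuum.FouriersLaw.Theorems.LatticeLandauDampingAbelThermodynamicLimitFixedFrequencyMatchingUniformLeaves
import Summits.AtomisticToContinuum.FouriersLaw.Theorems.JunctionLocalityNonBallisticStubBulkAnchorMatchingOfDynamicalMatching

/-!
# Stub `stub_fixedTimeThermodynamicLimitOfBulkMatching` (F2) of line `drude-controls-conductance` (R2b) —
crux `JunctionLocality.NonBallistic` (stmt-AtomisticToContinuum-9127): anchor-uniform bulk matching (F1) ⇒ FTL∞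

Helper file (`--supports stmt-AtomisticToContinuum-9127`) proving the registered stub
`stub_fixedTimeThermodynamicLimitOfBulkMatching` VERBATIM (an implication `(F1) → (FTL∞)`); nothing here
closes the item.

For `P = pinnedChain ω₂ lam β γ` (all `> 0`), `T > 0`, the equilibrium total-current autocorrelation of the
OPEN `N`-chain with both Langevin baths at `T`,
`C_N(s) = ∫ J · (κ_s J) dπ_{N,T} = Σ_{i,k} A_{ik}(s)`, `A_{ik}(s) = ⟨j_i(0) j_k(s)⟩_{N,T} = ∫ j_i · (κ_s j_k) dπ_{N,T}`
(`J = Σ_i j_i`, `κ_s = transitionKernel N T T s⁺`, `π_{N,T} = gibbsMeasure N T`), and an admissible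
infinite-volume pair `(μ, D)` (shift-invariant DLR state `μ` at `T`; dynamics `D` with `carrier ⊆ bmGood`,
preserving `μ`, absolutely convergent current correlations `a_x(s) = ∫ j_0 · (j_x ∘ φ_s) dμ`,
`C_∞(s) = D.currentCorrelation μ s = Σ_x a_x(s)`):

(F1) ANCHOR-UNIFORM PER-OFFSET MATCHING in the bulk — for every offset `x`, `s ≥ 0`, `ε > 0` there are
`L, N₀` with `|A_{a,a+x}(s) - a_x(s)| ≤ ε` for all `N ≥ N₀` and all anchors `L ≤ a`, `a + L < N` —
implies the FIXED-TIME THERMODYNAMIC LIMIT `C_N(s)/N → C_∞(s)` for every `s ≥ 0`.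

Route (tree theorems only). The bond average `C_N(s)/N = (1/N) Σ_i Σ_k A_{ik}(s)` was carried out once
and for all in the twin line `series-law-at-every-laplace-frequency`
(`SeriesLawAtEveryLaplaceFrequency.tendsto_totalCurrentAutocorr_div_of_uniformLeaves`, file
`LatticeLandauDampingAbelThermodynamicLimitFixedFrequencyMatchingUniformLeaves`): bulk rows
`Σ_k A_{ik}` are within `3ε` of `C_∞(s)` (window `|k - i| ≤ R` offset by offset by the anchor-uniform
matching, open-chain tail by the anchor-uniform correlation tails, witness tail by absolute convergence),
and the `≤ 2L` near-end rows are `≤ ½(λM + 3MN/λ)` by the weighted pairing bound (AM–GM + the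
`L²(π_{N,T})`-contraction of `κ_s`, site-uniform second moments `⟨j_k²⟩ ≤ M`), i.e. `o(N)` in the bond
average. Its two dynamical inputs at the fixed time `s` are: (B′) the `dite`-free `∀ i k : Fin N` form of
the hypothesis (F1) (`uniformFixedTimeOffsetMatching_of_bulkAnchorMatching`: for `L`-deep anchors the
registered `dite` sits in its `then` branch), and (C′) the LANDED anchor-uniform `N`-uniform correlation
tails `LoomisCompactHorizonWitness.uniformAnchoredCorrelationTails` at `τ = max s 1`
(`SeriesLawAtEveryLaplaceFrequency.uniformAnchoredCorrelationTails_pointwise`, which needs `0 ≤ s`).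

All statements proved; `[folklore]`. No definitions.
-/

noncomputable section

namespace Summit.AtomisticToContinuum.FouriersLaw.Theorems.NonBallistic

open MeasureTheory ProbabilityTheory Set Filter Topology Function
open scoped NNReal ENNReal BigOperators
open Literature.MathematicalPhysics.KineticTheory Literature.MathematicalPhysics.KineticTheory.HeatConduction
open Literature.Probability.Process OscillatorChain
open Summit.AtomisticToContinuum.FouriersLaw.Theorems.AbelThermodynamicLimit.LoomisCompactHorizonWitness
  (uniformAnchoredCorrelationTails)
open Summit.AtomisticToContinuum.FouriersLaw.Theorems.AbelThermodynamicLimit.SeriesLawAtEveryLaplaceFrequency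
  (uniformAnchoredCorrelationTails_pointwise tendsto_totalCurrentAutocorr_div_of_uniformLeaves)

/-- **(F1) in the `dite`-free form (B′).** The registered anchor-uniform per-offset matching, stated over
natural anchors `a` with a `dite` guard, gives at every fixed `s ≥ 0` the `∀ i k : Fin N` form used by the bond
average: for a genuine bond `k` with `k = i + x` and an `L`-deep anchor `i` the guard
`0 ≤ i + x < N ∧ i < N` holds, and the two pair correlations coincide. [folklore] -/
theorem uniformFixedTimeOffsetMatching_of_bulkAnchorMatching {ω₂ lam β γ T : ℝ} {μ : Measure ChainConfig}
    {D : InfiniteChainDynamics (pinnedChain ω₂ lam β γ)} {s : ℝ}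
    (hF1 : ∀ (x : ℤ) (ε : ℝ), 0 < ε → ∃ L N₀ : ℕ, ∀ N : ℕ, N₀ ≤ N → ∀ a : ℕ, L ≤ a → a + L < N →
      |(if h : 0 ≤ (a : ℤ) + x ∧ (a : ℤ) + x < N ∧ a < N then
          ∫ z, (pinnedChain ω₂ lam β γ).bondCurrent N ⟨a, h.2.2⟩ z *
            (∫ y, (pinnedChain ω₂ lam β γ).bondCurrent N ⟨((a : ℤ) + x).toNat, by omega⟩ y
              ∂((pinnedChain ω₂ lam β γ).transitionKernel N T T s.toNNReal z))
            ∂((pinnedChain ω₂ lam β γ).gibbsMeasure N T)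
        else 0) -
        ∫ σ, (pinnedChain ω₂ lam β γ).bondCurrentZ σ 0 * (pinnedChain ω₂ lam β γ).bondCurrentZ (D.flow s σ) x ∂μ| ≤ ε) :
    ∀ (x : ℤ) (ε : ℝ), 0 < ε → ∃ L N₀ : ℕ, ∀ N : ℕ, N₀ ≤ N → ∀ i k : Fin N,
      L ≤ i.val → i.val + L < N → (k.val : ℤ) = i.val + x →
        |(∫ z, (pinnedChain ω₂ lam β γ).bondCurrent N i z *
            (∫ y, (pinnedChain ω₂ lam β γ).bondCurrent N k y
              ∂((pinnedChain ω₂ lam β γ).transitionKernel N T T s.toNNReal z))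
            ∂((pinnedChain ω₂ lam β γ).gibbsMeasure N T)) -
          ∫ σ, (pinnedChain ω₂ lam β γ).bondCurrentZ σ 0 *
            (pinnedChain ω₂ lam β γ).bondCurrentZ (D.flow s σ) x ∂μ| ≤ ε := by
  intro x ε hε
  obtain ⟨L, N₀, h⟩ := hF1 x ε hε
  refine ⟨L, N₀, fun N hN i k hLi hiL hk => ?_⟩
  obtain ⟨kv, hkv⟩ := k
  have hk' : (kv : ℤ) = i.val + x := hk
  have h1 := h N hN i.val hLi hiL
  have hcond : 0 ≤ (i.val : ℤ) + x ∧ (i.val : ℤ) + x < N ∧ i.val < N := ⟨by omega, by omega, i.isLt⟩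
  rw [dif_pos hcond] at h1
  obtain rfl : kv = ((i.val : ℤ) + x).toNat := by omega
  exact h1

/-- **Registered stub `stub_fixedTimeThermodynamicLimitOfBulkMatching`** (F2, stub 15 of line
`drude-controls-conductance`, R2b; harmonic-true): anchor-uniform bulk matching (F1) ⇒ FTL∞ — for the pinned
chain (all parameters `> 0`), `T > 0`, the equilibrium total-current autocorrelation `C` pinned by its defining
equation and every admissible pair `(μ, D)`, `C_N(s)/N → D.currentCorrelation μ s` for every `s ≥ 0`.
`C_N(s) = Σ_{i,k} A_{ik}(s)`; bulk rows: window terms `A_{i,i+x}(s) → a_x(s)` uniformly over bulk anchors (F1),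
tails `Σ_{|k-i|>R} |A_{ik}(s)| ≤ ε` uniformly (`uniformAnchoredCorrelationTails`, landed),
`Σ_{|x|≤R} a_x(s) → C_∞(s)` (absolute convergence); near-end rows (`i < L` or `i + L ≥ N`) are `o(N)` by the
weighted pairing bound; assembled by the twin line's bond average
`tendsto_totalCurrentAutocorr_div_of_uniformLeaves`. [folklore] -/
theorem stub_fixedTimeThermodynamicLimitOfBulkMatching :
    (∀ ω₂ lam β γ : ℝ, 0 < ω₂ → 0 < lam → 0 < β → 0 < γ → ∀ T : ℝ, 0 < T →
          ∀ (μ : Measure ChainConfig) (D : InfiniteChainDynamics (pinnedChain ω₂ lam β γ)),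
            (pinnedChain ω₂ lam β γ).IsChainGibbsMeasure T μ → IsShiftInvariant μ →
            D.carrier ⊆ (pinnedChain ω₂ lam β γ).bmGood → D.PreservesMeasure μ →
            (∀ t : ℝ, D.HasAbsConvergentCorrelation μ t) →
            ∀ (x : ℤ) (t : ℝ), 0 ≤ t → ∀ ε : ℝ, 0 < ε → ∃ L N₀ : ℕ, ∀ N : ℕ, N₀ ≤ N →
              ∀ a : ℕ, L ≤ a → a + L < N →
              |(if h : 0 ≤ (a : ℤ) + x ∧ (a : ℤ) + x < N ∧ a < N then
                  ∫ z, (pinnedChain ω₂ lam β γ).bondCurrent N ⟨a, h.2.2⟩ z *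
                    (∫ y, (pinnedChain ω₂ lam β γ).bondCurrent N ⟨((a : ℤ) + x).toNat, by omega⟩ y
                      ∂((pinnedChain ω₂ lam β γ).transitionKernel N T T t.toNNReal z))
                    ∂((pinnedChain ω₂ lam β γ).gibbsMeasure N T)
                else 0) -
                ∫ σ, (pinnedChain ω₂ lam β γ).bondCurrentZ σ 0 * (pinnedChain ω₂ lam β γ).bondCurrentZ (D.flow t σ) x ∂μ| ≤ ε) →
    ∀ ω₂ lam β γ : ℝ, 0 < ω₂ → 0 < lam → 0 < β → 0 < γ → ∀ T : ℝ, 0 < T →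
        ∀ C : ℕ → ℝ → ℝ,
          C = (fun (N : ℕ) (s : ℝ) => ∫ x, (∑ i : Fin N, (pinnedChain ω₂ lam β γ).bondCurrent N i x) *
                (∫ y, (∑ i : Fin N, (pinnedChain ω₂ lam β γ).bondCurrent N i y)
                  ∂((pinnedChain ω₂ lam β γ).transitionKernel N T T s.toNNReal x))
                ∂((pinnedChain ω₂ lam β γ).gibbsMeasure N T)) →
          ∀ (μ : Measure ChainConfig) (D : InfiniteChainDynamics (pinnedChain ω₂ lam β γ)),
            (pinnedChain ω₂ lam β γ).IsChainGibbsMeasure T μ → IsShiftInvariant μ →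
            D.carrier ⊆ (pinnedChain ω₂ lam β γ).bmGood → D.PreservesMeasure μ →
            (∀ t : ℝ, D.HasAbsConvergentCorrelation μ t) →
            ∀ s : ℝ, 0 ≤ s →
              Tendsto (fun N : ℕ => C N s / (N : ℝ)) atTop (𝓝 (D.currentCorrelation μ s)) := by
  intro hF1 ω₂ lam β γ hω hl hβ hγ T hT C hC μ D hG hS hcar hPres hAC s hs
  -- (B′) at time `s`: the `dite`-free form of (F1) at this parameter point and witness
  have hB := uniformFixedTimeOffsetMatching_of_bulkAnchorMatching (T := T) (μ := μ) (D := D) (s := s)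
    (fun x ε hε => hF1 ω₂ lam β γ hω hl hβ hγ T hT μ D hG hS hcar hPres hAC x s hs ε hε)
  -- (C′) at time `s`: the landed anchor-uniform correlation tails on `[0, max s 1]`
  have hCt := uniformAnchoredCorrelationTails_pointwise
    (uniformAnchoredCorrelationTails ω₂ lam β γ hω hl hβ hγ T hT) hs
  -- the bond average of the twin line
  subst hC
  exact tendsto_totalCurrentAutocorr_div_of_uniformLeaves hω hl hβ hγ hT (hAC s) hB hCt

end Summit.AtomisticToContinuum.FouriersLaw.Theorems.NonBallistic

end
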